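import Summits.KontsevichZagierPeriods.KontsevichZagierPeriods.Theorems.SoloBlindEnneaCoverPullback
import Summits.KontsevichZagierPeriods.KontsevichZagierPeriods.Theorems.SoloBlindQuarticTwist
import Summits.KontsevichZagierPeriods.KontsevichZagierPeriods.Theorems.SoloBlindOctaCover
import HarnessLib

/-!
# The level-18 cover merge: `β(1/9,1/6) ≐ β(1/6,1/3)` inside the Kontsevich–Zagier rules

Conclusion of `SoloBlindEnneaCoverPrep` / `SoloBlindEnneaCoverPullback`.  Running the forms
through the rules — one substitution `t = F(W)` on `(0,1)` (the degree-four map `F` is a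
decreasing diffeomorphism of `(0,1)`), two integrand additivities and three Kummer substitutions
`s = W³` — gives the **cover relation** in `Q = ℤ[reps]/relations`

  `β(1/6,1/3) = k₀ • β(1/9,1/6) + k₁ • β(4/9,1/6) + k₂ • β(7/9,1/6)`,
  `k₀ = -λv/3`, `k₁ = -λu/3`, `k₂ = -λ/3`, `λ = b^{1/3}`   (`betaQ_enneaCover`),

with the algebraic constants `b, u, v` of the Prep file (numerically both periods are
`8.41309…`).  At level `18` the orbits `{8,3,7} = β(4/9,1/6)` and `{14,3,1} = β(7/9,1/6)` are
already merged with `{2,3,13} = β(1/9,1/6)` in the rules (reflection orbits + the quartic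
families `SoloBlindQuartic`, `SoloBlindQuarticTwist`: `betaQ_propTo_eighteen_V/W`), so the three
unknowns collapse to one and positivity of the periods gives the non-vanishing of the resulting
coefficient:

  **`betaQ_propTo_enneaCover : β(1/9,1/6) ≐ β(1/6,1/3)`**.

With it the in-rules classes of the `45` first-kind Beta values `B(i/18, j/18)` are exactly the
four Deligne–Koblitz–Ogus classes (value classes modulo `\bar ℚ^×` predicted by the period
conjecture): level `18` of the first kind is complete, like levels `≤ 12`.
-/

noncomputable section

open Set MeasureTheory MvPolynomial

namespace Summit.KontsevichZagierPeriods.KontsevichZagierPeriods.Theorems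

namespace SoloBlind

open Literature.ModelTheory.ExponentialFields (IsSemialgebraic)
open Literature.NumberTheory.Transcendental
open Literature.NumberTheory.Transcendental.KZ

/-! ## The representations (all on the line `(0,1)`) -/

/-- `R_j = [(0,1), 3 W^j E(W)]`. -/
def enR (j : ℕ) : IntegralRep 1 :=
  lineRep (Ioo 0 1) (fun v => 3 * (v ^ j * enE v)) mix_line_sa (sa_enR j) (integrableOn_enR j)

/-- `Θ = [(0,1), θ]`. -/
def enThetaRep : IntegralRep 1 :=
  lineRep (Ioo 0 1) enTheta mix_line_sa sa_enTheta_unit integrableOn_enTheta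

/-- `-λv/3` is algebraic. -/
theorem isAlgebraic_enL0 : IsAlgebraic ℚ (-(enL * enV / 3)) :=
  ((isAlgebraic_enL.mul isAlgebraic_enV).mul
    (by simpa using isAlgebraic_rat ℚ (A := ℝ) 3⁻¹)).neg

/-- `-λu/3` is algebraic. -/
theorem isAlgebraic_enL1 : IsAlgebraic ℚ (-(enL * enU / 3)) :=
  ((isAlgebraic_enL.mul isAlgebraic_enU).mul
    (by simpa using isAlgebraic_rat ℚ (A := ℝ) 3⁻¹)).neg

/-- `-λ/3` is algebraic. -/
theorem isAlgebraic_enL2 : IsAlgebraic ℚ (-(enL / 3)) :=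
  (isAlgebraic_enL.mul (by simpa using isAlgebraic_rat ℚ (A := ℝ) 3⁻¹)).neg

/-- The integrand of `T₁₂` is integrable on `(0,1)`. -/
theorem integrableOn_enT12 : IntegrableOn (fun v => -(enL * enU / 3) * (3 * (v ^ 1 * enE v)) +
    -(enL / 3) * (3 * (v ^ 2 * enE v))) (Ioo 0 1) :=
  ((integrableOn_enR 1).const_mul (-(enL * enU / 3))).add
    ((integrableOn_enR 2).const_mul (-(enL / 3)))

/-- The integrand of `T₁₂` is `ℚ`-semialgebraic on `(0,1)`. -/
theorem sa_enT12 : IsSemialgebraicFunOn ℚ (line (Ioo (0:ℝ) 1))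
    (fun x : Fin 1 → ℝ => -(enL * enU / 3) * (3 * (x 0 ^ 1 * enE (x 0))) +
      -(enL / 3) * (3 * (x 0 ^ 2 * enE (x 0)))) :=
  (IsSemialgebraicFunOn.add_holds (sa_const_poly_enE isAlgebraic_enL1 (3 * X 0 ^ 1))
    (sa_const_poly_enE isAlgebraic_enL2 (3 * X 0 ^ 2))).congr fun x _ => by
    simp only [Pi.add_apply, map_mul, map_pow, map_ofNat, aeval_X]; ring

/-- `T₁₂ = [(0,1), (-λu/3)·3WE + (-λ/3)·3W²E]`. -/
def enT12 : IntegralRep 1 :=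
  lineRep (Ioo 0 1) (fun v => -(enL * enU / 3) * (3 * (v ^ 1 * enE v)) +
    -(enL / 3) * (3 * (v ^ 2 * enE v))) mix_line_sa sa_enT12 integrableOn_enT12

/-! ## The moves -/

/-- **Move 1 (Kummer):** `R_j ≡ β(a_j, 1/6)` (substitution `s = W³`). -/
theorem enR_sub_betaRep (j : ℕ) :
    of (enR j) - of (betaRep (enA j) (1 / 6) (enA_pos j) (by norm_num)) ∈ relations := by
  unfold enR betaRep
  exact lineRep_subst (fun v => v ^ 3) (fun v => 3 * v ^ 2) isSemialgebraicFunOn_pow_three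
    (fun v _ => hasDerivWithinAt_pow_three _ v) injOn_pow_three image_pow_three
    (fun v hv => en_cube hv j)

/-- **Move 2 (the cover):** `Θ ≡ β(1/6,1/3)` (substitution `t = F(W)` on `(0,1)`). -/
theorem enThetaRep_sub_betaRep :
    of enThetaRep - of (betaRep (1 / 6) (1 / 3) (by norm_num) (by norm_num)) ∈ relations := by
  unfold enThetaRep betaRep
  exact lineRep_subst enF enF' sa_enF_unit
    (fun W hW => (hasDerivAt_enF hW.1.le).hasDerivWithinAt) injOn_enF image_enF
    (fun W hW => en_pull hW)

/-- **Move 3:** `Θ ≡ (-λv/3)·R₀ + T₁₂` (integrand additivity). -/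
theorem enThetaRep_sub_sub :
    of enThetaRep - of ((enR 0).constMul (-(enL * enV / 3)) isAlgebraic_enL0) - of enT12 ∈
      relations :=
  of_sub_sub_mem_relations_of_add rfl rfl fun x _ => by
    simp only [enThetaRep, enR, enT12, lineRep_integrand, IntegralRep.integrand_constMul,
      enTheta, enS]
    ring

/-- **Move 4:** `T₁₂ ≡ (-λu/3)·R₁ + (-λ/3)·R₂`. -/
theorem enT12_sub_sub :
    of enT12 - of ((enR 1).constMul (-(enL * enU / 3)) isAlgebraic_enL1) -
      of ((enR 2).constMul (-(enL / 3)) isAlgebraic_enL2) ∈ relations :=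
  of_sub_sub_mem_relations_of_add rfl rfl fun x _ => by
    simp only [enR, enT12, lineRep_integrand, IntegralRep.integrand_constMul]

/-! ## In `Q` -/

/-- The three coefficients as elements of `K₀`. -/
def enK (j : Fin 3) : K₀ :=
  ⟨![-(enL * enV / 3), -(enL * enU / 3), -(enL / 3)] j, mem_K₀_iff.mpr (by
    fin_cases j
    · exact isAlgebraic_enL0
    · exact isAlgebraic_enL1
    · exact isAlgebraic_enL2)⟩

/-- `(k₀ : ℝ) = -λv/3`. -/
@[simp] theorem coe_enK_zero : ((enK 0 : K₀) : ℝ) = -(enL * enV / 3) := rfl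

/-- `(k₁ : ℝ) = -λu/3`. -/
@[simp] theorem coe_enK_one : ((enK 1 : K₀) : ℝ) = -(enL * enU / 3) := rfl

/-- `(k₂ : ℝ) = -λ/3`. -/
@[simp] theorem coe_enK_two : ((enK 2 : K₀) : ℝ) = -(enL / 3) := rfl

/-- `[R_j] = β(a_j, 1/6)`. -/
theorem enR_eq (j : ℕ) : mkQ (of (enR j)) = betaQ (enA j) (1 / 6) := by
  rw [betaQ_eq (enA_pos j) (by norm_num)]
  exact mkQ_eq_mkQ_iff.mpr (enR_sub_betaRep j)

/-- `[a·R_j] = a • β(a_j, 1/6)`. -/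
theorem enR_constMul_eq (j : ℕ) {a : ℝ} (ha : IsAlgebraic ℚ a) :
    mkQ (of ((enR j).constMul a ha)) =
      (⟨a, mem_K₀_iff.mpr ha⟩ : K₀) • betaQ (enA j) (1 / 6) := by
  rw [mkQ_constMul, enR_eq]

/-- `[Θ] = β(1/6,1/3)`. -/
theorem enThetaRep_eq : mkQ (of enThetaRep) = betaQ (1 / 6) (1 / 3) := by
  rw [betaQ_eq (by norm_num : (0:ℚ) < 1 / 6) (by norm_num : (0:ℚ) < 1 / 3)]
  exact mkQ_eq_mkQ_iff.mpr enThetaRep_sub_betaRep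

/-- **The cover relation** inside the Kontsevich–Zagier rules:
`β(1/6,1/3) = (-λv/3) • β(1/9,1/6) + (-λu/3) • β(4/9,1/6) + (-λ/3) • β(7/9,1/6)`. -/
theorem betaQ_enneaCover : betaQ (1 / 6) (1 / 3) = enK 0 • betaQ (1 / 9) (1 / 6) +
    (enK 1 • betaQ (4 / 9) (1 / 6) + enK 2 • betaQ (7 / 9) (1 / 6)) := by
  have a0 : enA 0 = 1 / 9 := by unfold enA; norm_num
  have a1 : enA 1 = 4 / 9 := by unfold enA; norm_num
  have a2 : enA 2 = 7 / 9 := by unfold enA; norm_num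
  have h1 := enThetaRep_eq
  have h2 : mkQ (of enThetaRep) =
      mkQ (of ((enR 0).constMul (-(enL * enV / 3)) isAlgebraic_enL0)) + mkQ (of enT12) := by
    rw [← map_add, mkQ_eq_mkQ_iff]
    have h := enThetaRep_sub_sub
    rwa [sub_sub] at h
  have h3 : mkQ (of enT12) = mkQ (of ((enR 1).constMul (-(enL * enU / 3)) isAlgebraic_enL1)) +
      mkQ (of ((enR 2).constMul (-(enL / 3)) isAlgebraic_enL2)) := by
    rw [← map_add, mkQ_eq_mkQ_iff]
    have h := enT12_sub_sub
    rwa [sub_sub] at h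
  rw [h2, h3, enR_constMul_eq, enR_constMul_eq, enR_constMul_eq, a0, a1, a2] at h1
  exact h1.symm

/-- Period check: `B(1/6,1/3) = -(λ/3)(v B(1/9,1/6) + u B(4/9,1/6) + B(7/9,1/6))`
(numerically both sides are `8.41309…`). -/
theorem beta_enneaCover_value :
    evalQ (betaQ (1 / 6) (1 / 3)) = -(enL * enV / 3) * evalQ (betaQ (1 / 9) (1 / 6)) +
      (-(enL * enU / 3) * evalQ (betaQ (4 / 9) (1 / 6)) +
        -(enL / 3) * evalQ (betaQ (7 / 9) (1 / 6))) := by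
  have h := congrArg evalQ betaQ_enneaCover
  rw [map_add, map_add, evalQ_smul, evalQ_smul, evalQ_smul, coe_enK_zero, coe_enK_one,
    coe_enK_two] at h
  exact h

/-! ## The links already in the rules at level 18 -/

/-- `β(4/9,1/6) ≐ β(1/9,1/6)`: the reflection orbit `{8,3,7} → {8,7,3}` followed by the twisted
quartic family at `x = 1/9` (`β(1/9,1/6) ≐ β(7/18,4/9)`). -/
theorem betaQ_propTo_eighteen_V : PropTo (betaQ (4 / 9) (1 / 6)) (betaQ (1 / 9) (1 / 6)) := by
  have h1 := orbit_pair (4 / 9) (1 / 6) (7 / 18) (by norm_num) (by norm_num) (by norm_num)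
    (by norm_num)
  have hs7 := sinQ_coe_pos (show (0:ℚ) < 7 / 18 by norm_num) (by norm_num)
  have hs6 := sinQ_coe_pos (show (0:ℚ) < 1 / 6 by norm_num) (by norm_num)
  have hA : PropTo (betaQ (4 / 9) (1 / 6)) (betaQ (4 / 9) (7 / 18)) :=
    (PropTo.of_smul_eq_smul (K₀_ne_zero_of_pos hs7) (K₀_ne_zero_of_pos hs6) h1).symm
  rw [betaQ_symm (show (0:ℚ) < 4 / 9 by norm_num) (show (0:ℚ) < 7 / 18 by norm_num)] at hA
  have hB := betaQ_propTo_quarticTwist (1 / 9) (by norm_num) (by norm_num)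
  rw [show (1:ℚ) / 2 - 3 * (1 / 9) = 1 / 6 by norm_num,
    show (1:ℚ) / 2 - 1 / 9 = 7 / 18 by norm_num, show (4:ℚ) * (1 / 9) = 4 / 9 by norm_num] at hB
  exact hA.trans hB.symm

/-- `β(7/9,1/6) ≐ β(1/9,1/6)`: the reflection orbit `{14,3,1} → {14,1,3}`, the quartic family at
`x = 1/18` (`β(1/18,7/9) ≐ β(1/6,4/9)`) and the previous link. -/
theorem betaQ_propTo_eighteen_W : PropTo (betaQ (7 / 9) (1 / 6)) (betaQ (1 / 9) (1 / 6)) := by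
  have h1 := orbit_pair (7 / 9) (1 / 6) (1 / 18) (by norm_num) (by norm_num) (by norm_num)
    (by norm_num)
  have hs1 := sinQ_coe_pos (show (0:ℚ) < 1 / 18 by norm_num) (by norm_num)
  have hs6 := sinQ_coe_pos (show (0:ℚ) < 1 / 6 by norm_num) (by norm_num)
  have hA : PropTo (betaQ (7 / 9) (1 / 6)) (betaQ (7 / 9) (1 / 18)) :=
    (PropTo.of_smul_eq_smul (K₀_ne_zero_of_pos hs1) (K₀_ne_zero_of_pos hs6) h1).symm
  rw [betaQ_symm (show (0:ℚ) < 7 / 9 by norm_num) (show (0:ℚ) < 1 / 18 by norm_num)] at hA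
  have hB := betaQ_propTo_quartic (1 / 18) (by norm_num) (by norm_num)
  rw [show (1:ℚ) - 4 * (1 / 18) = 7 / 9 by norm_num,
    show (3:ℚ) * (1 / 18) = 1 / 6 by norm_num, show (1:ℚ) / 2 - 1 / 18 = 4 / 9 by norm_num,
    betaQ_symm (show (0:ℚ) < 1 / 6 by norm_num) (show (0:ℚ) < 4 / 9 by norm_num)] at hB
  exact (hA.trans hB).trans betaQ_propTo_eighteen_V

/-! ## The merge -/

/-- **The cover merge at level 18: `β(1/9,1/6) ≐ β(1/6,1/3)`** — the orbits
`{2,3,13} ~ {3,7,8} ~ {1,3,14}` join the Deligne–Koblitz–Ogus class of `{3,6,9}` inside the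
Kontsevich–Zagier rules; with it every first-kind DKO class at level `18` is a single in-rules
class. -/
theorem betaQ_propTo_enneaCover : PropTo (betaQ (1 / 9) (1 / 6)) (betaQ (1 / 6) (1 / 3)) := by
  obtain ⟨l₁, -, hl₁⟩ := betaQ_propTo_eighteen_V
  obtain ⟨l₂, -, hl₂⟩ := betaQ_propTo_eighteen_W
  have hrel :
      betaQ (1 / 6) (1 / 3) = (enK 0 + enK 1 * l₁ + enK 2 * l₂) • betaQ (1 / 9) (1 / 6) := by
    rw [betaQ_enneaCover, hl₁, hl₂]
    module
  have hBT := evalQ_betaQ_pos (show (0:ℚ) < 1 / 6 by norm_num) (show (0:ℚ) < 1 / 3 by norm_num)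
  have hM : enK 0 + enK 1 * l₁ + enK 2 * l₂ ≠ 0 := by
    intro h0
    have h := congrArg evalQ hrel
    rw [h0, zero_smul, map_zero] at h
    linarith
  exact PropTo.symm ⟨_, hM, hrel⟩

/-- The merge read in the other direction: `β(1/6,1/3) ≐ β(1/9,1/6)`. -/
theorem betaQ_propTo_enneaCover' : PropTo (betaQ (1 / 6) (1 / 3)) (betaQ (1 / 9) (1 / 6)) :=
  betaQ_propTo_enneaCover.symm

end SoloBlind

end Summit.KontsevichZagierPeriods.KontsevichZagierPeriods.Theorems
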